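import Mathlib
import Literature.Barriers.PneNP.TSPExtensionComplexity
import Literature.Barriers.PneNP.TSPExtensionComplexityFaces
import HarnessLib

/-!
# Yannakakis' factorisation theorem — the converse half, for a complete (possibly infinite) inequality family

The tree measures extension complexity in the slack-form currency of Fiorini–Massar–Pokutta–Tiwary–de Wolf
(`Literature.Barriers.PneNP.HasEFOfSize P r`, `TSPExtensionComplexity.lean`).  `TSPExtensionComplexityHyperplaneBound.lean`
has the forward half of Yannakakis' factorisation theorem (`HasEFOfSize.exists_nonneg_factorization`: an EF of size `r`
yields a nonnegative factorisation of every slack matrix through `r + 1` slots).  This file supplies the CONVERSE half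
(Yannakakis 1991 Thm 3, the LP (L2) `Cx + Fy = d, y ≥ 0` of its proof; FMPTdW Theorem 3 (§3.1), direction (i) ⇒ (iii): "consider a
rank-`r` nonnegative factorization `S = TU` of the slack matrix of `P` … `P` is the image of `Q = {(x, y) | Ax + Ty = b, y ≥ 0}`"),
in the generality the summit-side users need:

* `hasEFOfSize_of_complete_nonneg_factorization` — let `P = conv(v_b : b ∈ B)` and let `(c_a · x ≤ d_a)_{a ∈ A}` be a
  family of linear inequalities, indexed by an ARBITRARY (possibly infinite) type `A`, that is COMPLETE for `P` (every
  point satisfying all of them lies in `P`).  If the slack matrix `d_a − c_a · v_b` factors as `Σ_{i ∈ σ} U_a(i) W_b(i)`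
  with `U, W ≥ 0` and `σ` finite, then `HasEFOfSize P |σ|`.

## Proof

The candidate EF is the slack-form system `{x | ∃ y ≥ 0, ∀ a, c_a · x + U_a · y = d_a}`.  Finitely many of its equations
suffice: the triples `(c_a, U_a, d_a)` span a finite-dimensional space, a finite spanning subset (`IsNoetherian.noetherian`)
defines the same solution set because each equation is linear in its triple (`slackRowTriple_eq_of_mem_span`), and
`hasEFOfSize_of_system` re-indexes the finite system by `Fin`.  Its projection is exactly `P`: `⊇` — every generator `v_b`
lifts with `y = W_b` (the factorisation identities) and the projection is convex; `⊆` — `y ≥ 0`, `U ≥ 0` give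
`c_a · x ≤ d_a` for every `a`, then completeness.  Validity of the rows on `P` is automatic (the slacks are nonnegative)
and is not assumed.  No new definition, no named fact;
Mathlib linear algebra only.

## References

* M. Yannakakis, *Expressing combinatorial optimization problems by linear programs*, J. Comput. System Sci. 43 (1991)
  441–466, doi:10.1016/0022-0000(91)90024-y — Thm 3 (p. 457), the factorisation theorem `xc(P) = rank₊(S)`, and the LP (L2) of its proof.
* S. Fiorini, S. Massar, S. Pokutta, H. R. Tiwary, R. de Wolf, *Exponential lower bounds for polytopes in combinatorial
  optimization*, J. ACM 62 (2015), art. 17 = arXiv:1111.0837; §3.1 Theorem 3 ([Yannakakis91]) (arXiv p. 8), direction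
  (i) ⇒ (iii) via the proof sketch "(i) implies (ii)".
-/

set_option autoImplicit false

noncomputable section

namespace Literature.Barriers.PneNP

open Matrix Finset

variable {ι : Type} [Fintype ι] {A B σ : Type} [Fintype σ]

/-- A row `c_a · x + U_a · y = d_a` of a factorised slack-form system is encoded by its data triple `θ = (c_a, (U_a, d_a))`;
the equation `θ.1 · x + θ.2.1 · y = θ.2.2` is linear in the triple: if it holds on a set of triples it holds on their span (the step «at most finitely many linearly independent equations, the rest can be removed» of
Yannakakis' proof). [cite: Yannakakis1991, Thm 3 (p. 457), proof, LP (L2)] [cite: FioriniEtAl2015, Thm 3 (§3.1, arXiv p. 8), direction (i) ⇒ (iii)] -/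
theorem slackRowTriple_eq_of_mem_span (x : ι → ℝ) (y : σ → ℝ) (s : Set ((ι → ℝ) × ((σ → ℝ) × ℝ)))
    (hs : ∀ θ ∈ s, θ.1 ⬝ᵥ x + θ.2.1 ⬝ᵥ y = θ.2.2) :
    ∀ θ ∈ Submodule.span ℝ s, θ.1 ⬝ᵥ x + θ.2.1 ⬝ᵥ y = θ.2.2 := by
  intro θ hθ
  induction hθ using Submodule.span_induction with
  | mem θ h => exact hs θ h
  | zero => simp
  | add θ₁ θ₂ _ _ h₁ h₂ =>
    simp only [Prod.fst_add, Prod.snd_add, add_dotProduct]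
    linarith
  | smul c θ _ h =>
    simp only [Prod.smul_fst, Prod.smul_snd, smul_dotProduct, smul_eq_mul]
    rw [← h]
    ring

/-- **Yannakakis' factorisation theorem, converse half, for a complete inequality family.**  Let
`P = conv(v_b : b ∈ B)` and let `(c_a · x ≤ d_a)_{a ∈ A}` — `A` an arbitrary, possibly infinite, index type — be COMPLETE
for `P` (`hcomplete`: every point satisfying all the inequalities lies in `P`).  If the slack matrix `d_a − c_a · v_b` has a
nonnegative factorisation through a finite slot type `σ` (`hfac`, `U, W ≥ 0`), then `P` has an extended formulation of
size `|σ|` — namely `{x | ∃ y ≥ 0, ∀ a, c_a · x + U_a · y = d_a}` (finitely many equations suffice), whose projection is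
exactly `P`.  Validity of the rows is not assumed (it follows from `hfac`).
[cite: Yannakakis1991, Thm 3 (p. 457) and its proof, LP (L2): Cx + Fy = d, y ≥ 0 over a complete description]
[cite: FioriniEtAl2015, Thm 3 (§3.1, arXiv p. 8), direction (i) ⇒ (iii)] -/
theorem hasEFOfSize_of_complete_nonneg_factorization (v : B → ι → ℝ) (c : A → ι → ℝ) (d : A → ℝ)
    (hcomplete : ∀ x : ι → ℝ, (∀ a, c a ⬝ᵥ x ≤ d a) → x ∈ convexHull ℝ (Set.range v))
    (U : A → σ → ℝ) (W : B → σ → ℝ) (hU : ∀ a i, 0 ≤ U a i) (hW : ∀ b i, 0 ≤ W b i)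
    (hfac : ∀ a b, d a - c a ⬝ᵥ v b = ∑ i, U a i * W b i) :
    HasEFOfSize (convexHull ℝ (Set.range v)) (Fintype.card σ) := by
  classical
  -- the triples and a finite spanning subset of them
  let θf : A → (ι → ℝ) × ((σ → ℝ) × ℝ) := fun a => (c a, (U a, d a))
  obtain ⟨t, ht⟩ : (Submodule.span ℝ (Set.range θf)).FG := IsNoetherian.noetherian _
  -- the factorisation identities, as equations of the triples, on all of the span
  have hgen : ∀ b : B, ∀ θ ∈ Submodule.span ℝ (Set.range θf), θ.1 ⬝ᵥ v b + θ.2.1 ⬝ᵥ W b = θ.2.2 := by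
    intro b
    refine slackRowTriple_eq_of_mem_span (v b) (W b) (Set.range θf) ?_
    rintro _ ⟨a, rfl⟩
    have h := hfac a b
    show c a ⬝ᵥ v b + U a ⬝ᵥ W b = d a
    have hUW : U a ⬝ᵥ W b = ∑ i, U a i * W b i := rfl
    linarith
  -- the finite system
  let E : Matrix t ι ℝ := fun θ p => θ.1.1 p
  let Fm : Matrix t σ ℝ := fun θ i => θ.1.2.1 i
  let g : t → ℝ := fun θ => θ.1.2.2
  have hsys : ∀ (x : ι → ℝ) (y : σ → ℝ),
      E *ᵥ x + Fm *ᵥ y = g ↔ ∀ θ : t, θ.1.1 ⬝ᵥ x + θ.1.2.1 ⬝ᵥ y = θ.1.2.2 := by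
    intro x y
    constructor
    · intro h θ
      have := congrFun h θ
      simpa [E, Fm, g, mulVec] using this
    · intro h
      funext θ
      simpa [E, Fm, g, mulVec] using h θ
  have hEF := hasEFOfSize_of_system (ι := ι) E Fm g
  -- the system's projection is exactly `P`
  have key : {x : ι → ℝ | ∃ y : σ → ℝ, (∀ j, 0 ≤ y j) ∧ E *ᵥ x + Fm *ᵥ y = g} = convexHull ℝ (Set.range v) := by
    refine Set.Subset.antisymm ?_ ?_
    · -- `⊆ P`: every row inequality holds, then completeness
      rintro x ⟨y, hy, hxy⟩
      rw [hsys] at hxy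
      refine hcomplete x fun a => ?_
      have hθ : θf a ∈ Submodule.span ℝ (Set.range θf) := Submodule.subset_span ⟨a, rfl⟩
      rw [← ht] at hθ
      have heq : (θf a).1 ⬝ᵥ x + (θf a).2.1 ⬝ᵥ y = (θf a).2.2 :=
        slackRowTriple_eq_of_mem_span x y (↑t : Set ((ι → ℝ) × ((σ → ℝ) × ℝ))) (fun θ hθt => hxy ⟨θ, hθt⟩) (θf a) hθ
      have hUy : 0 ≤ U a ⬝ᵥ y := Finset.sum_nonneg fun i _ => mul_nonneg (hU a i) (hy i)
      change c a ⬝ᵥ x + U a ⬝ᵥ y = d a at heq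
      linarith
    · -- `P ⊆`: the projection is convex and contains every `v_b`
      have hconv : Convex ℝ {x : ι → ℝ | ∃ y : σ → ℝ, (∀ j, 0 ≤ y j) ∧ E *ᵥ x + Fm *ᵥ y = g} := by
        intro x₁ hx₁ x₂ hx₂ a' b' ha hb hab
        obtain ⟨y₁, hy₁, h₁⟩ := hx₁
        obtain ⟨y₂, hy₂, h₂⟩ := hx₂
        refine ⟨a' • y₁ + b' • y₂, fun j => ?_, ?_⟩
        · simp only [Pi.add_apply, Pi.smul_apply, smul_eq_mul]
          exact add_nonneg (mul_nonneg ha (hy₁ j)) (mul_nonneg hb (hy₂ j))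
        · rw [Matrix.mulVec_add, Matrix.mulVec_add, Matrix.mulVec_smul, Matrix.mulVec_smul, Matrix.mulVec_smul,
            Matrix.mulVec_smul]
          have : a' • (E *ᵥ x₁) + b' • (E *ᵥ x₂) + (a' • (Fm *ᵥ y₁) + b' • (Fm *ᵥ y₂))
              = a' • (E *ᵥ x₁ + Fm *ᵥ y₁) + b' • (E *ᵥ x₂ + Fm *ᵥ y₂) := by
            simp only [smul_add]; abel
          rw [this, h₁, h₂, ← add_smul, hab, one_smul]
      have hgens : Set.range v ⊆ {x : ι → ℝ | ∃ y : σ → ℝ, (∀ j, 0 ≤ y j) ∧ E *ᵥ x + Fm *ᵥ y = g} := by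
        rintro _ ⟨b, rfl⟩
        refine ⟨W b, fun i => hW b i, ?_⟩
        rw [hsys]
        intro θ
        have hθ : (θ.1 : (ι → ℝ) × ((σ → ℝ) × ℝ)) ∈ Submodule.span ℝ (Set.range θf) := by
          rw [← ht]
          exact Submodule.subset_span θ.2
        exact hgen b θ.1 hθ
      exact convexHull_min hgens hconv
  rw [key] at hEF
  exact hEF


end Literature.Barriers.PneNP

end
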